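import Summits.BirchSwinnertonDyer.BirchSwinnertonDyer.Theorems.CongruentShaFreeCutKatoDescentDatumOfH2
import Summits.BirchSwinnertonDyer.Rank1Residual.O5.HeegnerLogTransportThreeKrizLiGlue
import HarnessLib

set_option linter.dupNamespace false
set_option autoImplicit false

/-! # The torsion side of the reading (3.1″) of the Kato–zeta / Perrin-Riou road, PROVED for every `W`
# and every `p`: a Kummer witness with logarithm `0` is TORSION, so a pinned class with Kummer logarithm `0`
# has a non-zero multiple whose localisation vanishes at every finite level; and the pin transport
# «`p^j · (N · toH1 (eA a)) = 0` ⟹ `p^m · a = 0` in `D.A`»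

Cell `bsd-cn100`, prover seat `bsd-cn100-s2b-c3` (g6). THEOREMS ONLY (no definition, no named fact, no
instance); `W`- and `p`-generic plumbing shared by the two registered lines `kato-zeta-perrin-riou` — crux
B of route `CongruentShaFreeCut` (stmt-BirchSwinnertonDyer-19080, `(E_n, 2)`, v1b registered 20:53:39Z) and
crux B of route `MordellShaFreeCut` (stmt-BirchSwinnertonDyer-19160, `(W, 3)`, `j(W) = 0`, v1b proposed) —
whose stub `stub_reading31b` reads «in rank one with `Ш[p^∞]` finite, a pinned class `ι[z]` that is not
`ℤ_p`-torsion has NON-ZERO Kummer logarithm: `HasLocPKummerLog W p pin.katoClass t → t ≠ 0`» ([ABS] App. A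
§10.1.3: «Since `Sel_st(E)` is finite, it further follows that `0 ≠ loc_p(z_E)`» + AEC IV.6.4). That stub
has two halves:
* the LOCAL half — «`log_ω(Q) = 0` on `E(ℚ_p)` iff `Q` is torsion» — is a TREE THEOREM (cell `b2b-bsdres`,
  `Rank1Residual/Additive/PadicLogImage.lean`: `Additive.LocalLog.padicLog_eq_zero_iff`, AEC IV.6.4 /
  VII.6.3), once s2-c3's `Kato2004.padicLogLocal` (p462023) is identified with that cell's `padicLog`
  (§1, the eight-line computation of `O5.HeegnerLogTransportThreeKrizLiGlue.padicLogOmega_eq_padicLog` for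
  a LOCAL point); with the additivity of the tree's `localKummerMap` it gives §2: `HasLocPKummerLog W p x 0`
  ⟹ `∃ N ≠ 0, ∀ k, locModPk W p k (N • x) = 0` («`loc_p(N·x) = 0`» in finite-level currency);
* the GLOBAL half — «in rank one with `Ш[p^∞]` finite, `loc_p` on `H¹(ℤ[1/p], T_pW)` has torsion kernel»
  (Kato §14.1 + (14.9.3)) — is a named Literature fact filed separately by this seat
  (`Kato2004/LocPKernelRankOne.lean`, `locP_kernel_isTorsion_of_rankOne`), consumed together with §2–§3
  in `Theorems/CongruentShaFreeCutKatoReading31b.lean`.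
§3 is the pin transport back to the abstract datum: from `p^j · (N · toH1 (eA a)) = 0` in
`H¹(Γ_ℚ, T_pW)` to `p^m · a = 0` in `D.A` (`toH1`, `eA` injective; the prime-to-`p` part of `N` is a unit
of `Λ`). Imports the v2 pin (Theses-free) and the `b2b-bsdres` local-logarithm files — NO `Theses` module
(build rule 2026-08-26T19:10:10Z / (H)). HONEST FRAMING: plumbing; nothing about crux B of either route,
the congruent number problem, Sylvester's problem or BSD is proved. PARTITION: none — RANK axis.

References: [AlpogeBhargavaShnidman2022] App. A §10.1.2–§10.1.3 (pp. 33–34); [SilvermanAEC2009] IV.6.4,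
VII.6.3, VIII.§2; [Kato2004Asterisque] §14.14 (14.14.1) (p. 243); [BlochKato1990] Ex. 3.11.
-/

noncomputable section

open scoped Classical

namespace Summit.BirchSwinnertonDyer.BirchSwinnertonDyer.Theorems.CongruentShaFreeCutKatoKummerLogTorsion

open WeierstrassCurve Field Literature.NumberTheory.EllipticCurves
  Literature.NumberTheory.EllipticCurves.Kato2004 Literature.NumberTheory.EllipticCurves.IwasawaAlgebra
  Literature.NumberTheory.EllipticCurves.Kato2004.EulerSystemValues
  Literature.NumberTheory.GaloisRepresentations
open Summit.BirchSwinnertonDyer.Rank1Residual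
open Summit.BirchSwinnertonDyer.Rank1Residual.Additive (KatoDescentDatum)
open Summit.BirchSwinnertonDyer.BirchSwinnertonDyer.Theorems.CongruentShaFreeCutKatoDescentDatumOfH2

/-! ## §1 `Kato2004.padicLogLocal` IS the `b2b-bsdres` logarithm `Additive.LocalLog.padicLog` on `E(ℚ_p)` -/

section LocalLog

variable (W : WeierstrassCurve ℚ) [W.IsElliptic] [W.IsGloballyMinimal] (p : ℕ) [Fact p.Prime]

/-- **`log_ω(Q) = padicLog (W ⊗ ℚ_p) Q` for a LOCAL point `Q ∈ E(ℚ_p)`**: s2-c3's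
`padicLogLocal W p Q = log_W(z(m₀ • Q))/m₀` (`m₀ = [E(ℚ_p) : E₁(ℚ_p)]`, `formalIndex`) is the Additive
cell's `ℤ_p`-linear logarithm `L(N • Q)/N` (`N = [E(ℚ_p) : E⁽²⁾(ℚ_p)] = p·m₀`, `log_W z(p • Q') =
p·log_W z(Q')` on `E₁(ℚ_p)`) — the computation of `O5.….padicLogOmega_eq_padicLog` (there for the image
of a global point), verbatim for an arbitrary local point. [cite: SilvermanAEC2009, IV.6.4 and VII.6.3] -/
theorem padicLogLocal_eq_padicLog (Q : (W.baseChange ℚ_[p]).toAffine.Point) :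
    padicLogLocal W p Q = Additive.LocalLog.padicLog (W.baseChange ℚ_[p]) Q := by
  have hm : (W.baseChange ℚ_[p]).IsInReductionKernel
      (((W.baseChange ℚ_[p]).formalFiltration 1).index • Q) :=
    (((W.baseChange ℚ_[p]).formalFiltration 1).nsmul_index_mem _).1
  have hp0 : (p : ℚ_[p]) ≠ 0 := Nat.cast_ne_zero.mpr (Fact.out : p.Prime).ne_zero
  rw [Additive.LocalLog.padicLog_eq_padicLogPoint_nsmul_div, X11b.LocalIndex.index_formalFiltration_two,
    mul_nsmul', Additive.LocalLog.padicLogPoint_nsmul (W.baseChange ℚ_[p]) hm p, Nat.cast_mul,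
    mul_div_mul_left _ _ hp0]
  rfl

/-- **A local point with `log_ω = 0` is torsion** (the kernel of the `p`-adic logarithm on `E(ℚ_p)` is
the torsion subgroup: tree `Additive.LocalLog.padicLog_eq_zero_iff`, AEC IV.6.4 / VII.6.3).
[cite: SilvermanAEC2009, IV.6.4 and VII.6.3] -/
theorem isOfFinAddOrder_of_padicLogLocal_eq_zero {Q : (W.baseChange ℚ_[p]).toAffine.Point}
    (hQ : padicLogLocal W p Q = 0) : IsOfFinAddOrder Q := by
  rw [padicLogLocal_eq_padicLog] at hQ
  exact (Additive.LocalLog.padicLog_eq_zero_iff _ Q).mp hQ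

/-- Conversely a torsion local point has `log_ω = 0`. [cite: SilvermanAEC2009, IV.6.4 and VII.6.3] -/
theorem padicLogLocal_eq_zero_of_isOfFinAddOrder {Q : (W.baseChange ℚ_[p]).toAffine.Point}
    (hQ : IsOfFinAddOrder Q) : padicLogLocal W p Q = 0 := by
  rw [padicLogLocal_eq_padicLog]
  exact (Additive.LocalLog.padicLog_eq_zero_iff _ Q).mpr hQ

end LocalLog

/-! ## §2 A Kummer witness with logarithm `0`: `loc_p(N·x) = 0` at every finite level -/

section Kummer

variable (W : WeierstrassCurve ℚ) [W.IsElliptic] [W.IsGloballyMinimal] (p : ℕ) [Fact p.Prime]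
  [ContinuousSMul ℤ_[p] (W.tateModule p)]

/-- **`HasLocPKummerLog W p x 0` ⟹ a non-zero multiple of `x` has vanishing localisation at `p` modulo
every `p^k`.** The witness of `HasLocPKummerLog` is `m ≠ 0` and `Q ∈ E(ℚ_p)` with `loc_p(m·x) ≡ κ(Q)`
(mod `p^k`, all `k`) and `log_ω(Q) = m·0 = 0`; so `Q` is torsion (§1), say `n·Q = 0` with `n > 0`, and
`loc_p(nm·x) ≡ n·κ(Q) = κ(n·Q) = κ(0) = 0` at every level (`localKummerMap` and `locModPk` are additive).
[cite: AlpogeBhargavaShnidman2022, App. A §10.1.2–§10.1.3 (pp. 33–34)] [cite: SilvermanAEC2009, VIII.§2 and IV.6.4] -/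
theorem exists_forall_locModPk_nsmul_eq_zero_of_hasLocPKummerLog_zero (x : H1 (tateRep W p) ⊤)
    (h : HasLocPKummerLog W p x 0) :
    ∃ N : ℕ, N ≠ 0 ∧ ∀ k : ℕ, locModPk W p k (N • x) = 0 := by
  obtain ⟨m, Q, hm, hk, hlog⟩ := h
  rw [mul_zero] at hlog
  obtain ⟨n, hn, hnQ⟩ := (isOfFinAddOrder_of_padicLogLocal_eq_zero W p hlog).exists_nsmul_eq_zero
  refine ⟨n * m, Nat.mul_ne_zero hn.ne' hm, fun k ↦ ?_⟩
  have hQ' : n • W.localKummerMap ((primePlace p).adicCompletion ℚ)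
      (pow_ne_zero k (Int.natCast_ne_zero.mpr (Fact.out : p.Prime).ne_zero))
      (WeierstrassCurve.Affine.Point.map (padicToAdic p) Q) = 0 := by
    rw [← map_nsmul, ← map_nsmul, hnQ, map_zero, map_zero]
  rw [mul_nsmul', map_nsmul, hk k, hQ']

end Kummer

/-! ## §3 Pin transport: from `H¹(Γ_ℚ, T_pW)` back to the abstract datum `D.A` -/

section Transport

variable {W : WeierstrassCurve ℚ} [W.IsElliptic] {p : ℕ} [Fact p.Prime]
  [ContinuousSMul ℤ_[p] (W.tateModule p)] {D : KatoDescentDatum p} (P : KatoDescentDatumPinH2 W p D)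

/-- A natural number prime to `p` is a unit of `Λ = ℤ_p⟦T⟧` (its constant coefficient is a unit of `ℤ_p`).
[folklore] -/
theorem isUnit_natCast_iwasawaAlgebra_of_not_dvd {u : ℕ} (hu : ¬ p ∣ u) :
    IsUnit ((u : ℕ) : IwasawaAlgebra p) := by
  rw [PowerSeries.isUnit_iff_constantCoeff, map_natCast, PadicInt.isUnit_iff]
  refine le_antisymm (PadicInt.norm_le_one _) (not_lt.mp fun hlt ↦ hu ?_)
  have h := (PadicInt.norm_int_lt_one_iff_dvd (p := p) (u : ℤ)).mp (by exact_mod_cast hlt)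
  exact_mod_cast h

/-- `toH1 ∘ eA` transports the `ℕ`-action on `D.A` (through `Λ`, i.e. through the augmentation) to the
`ℕ`-action on `H¹(Γ_ℚ, T_pW)`. [cite: Kato2004Asterisque, §14.14 (14.14.1) (p. 243)] -/
theorem toH1_eA_nsmul (N : ℕ) (a : D.A) : P.J.toH1 (P.eA (N • a)) = N • P.J.toH1 (P.eA a) := by
  rw [map_nsmul, map_nsmul]

/-- **Pin transport of torsion**: if `p^j · (N · toH1 (eA a)) = 0` in `H¹(Γ_ℚ, T_pW)` with `N ≠ 0`, then
`p^m · a = 0` in `D.A` for some `m` (`toH1` and `eA` are injective and `ℤ_p`-compatible —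
`toH1_eA_natCast_pow_smul`; writing `N = p^b·u` with `p ∤ u`, `u` acts invertibly on the `Λ`-module
`D.A`). [cite: Kato2004Asterisque, §14.14 (14.14.1) (p. 243)] -/
theorem exists_pow_nsmul_eq_zero_of_pin {a : D.A} {j N : ℕ} (hN : N ≠ 0)
    (h : ((p : ℤ_[p]) ^ j) • (N • P.J.toH1 (P.eA a)) = 0) : ∃ m : ℕ, p ^ m • a = 0 := by
  obtain ⟨b, u, hu, rfl⟩ := Nat.exists_eq_pow_mul_and_not_dvd hN p (Fact.out : p.Prime).ne_one
  refine ⟨j + b, ?_⟩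
  -- move everything inside `toH1 ∘ eA`
  have h1 : P.J.toH1 (P.eA (((p : IwasawaAlgebra p) ^ j) • ((p ^ b * u) • a))) = 0 := by
    rw [P.toH1_eA_natCast_pow_smul, toH1_eA_nsmul, h]
  have h2 : ((p : IwasawaAlgebra p) ^ j) • ((p ^ b * u) • a) = 0 := by
    apply P.eA.injective
    apply P.J.toH1_injective
    rw [h1, map_zero, map_zero]
  -- `(p^b * u) • a = (p : Λ)^b • ((u : Λ) • a)` and `u` is a unit of `Λ`
  rw [← Nat.cast_smul_eq_nsmul (IwasawaAlgebra p), Nat.cast_mul, Nat.cast_pow, mul_smul, ← mul_smul,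
    ← pow_add] at h2
  obtain ⟨v, hv⟩ := isUnit_natCast_iwasawaAlgebra_of_not_dvd (p := p) hu
  have h3 : ((p : IwasawaAlgebra p) ^ (j + b)) • a = 0 := by
    have h4 : (v : IwasawaAlgebra p) • (((p : IwasawaAlgebra p) ^ (j + b)) • a) = 0 := by
      rw [hv, smul_comm]; exact h2
    have h5 : ((v⁻¹ : (IwasawaAlgebra p)ˣ) : IwasawaAlgebra p) •
        ((v : IwasawaAlgebra p) • (((p : IwasawaAlgebra p) ^ (j + b)) • a)) = 0 := by
      rw [h4, smul_zero]
    rwa [← mul_smul, Units.inv_mul, one_smul] at h5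
  rw [← Nat.cast_smul_eq_nsmul (IwasawaAlgebra p), Nat.cast_pow]
  exact h3

end Transport

end Summit.BirchSwinnertonDyer.BirchSwinnertonDyer.Theorems.CongruentShaFreeCutKatoKummerLogTorsion

end
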